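import Mathlib.Data.Finset.Prod
import Mathlib.Data.Finset.Image
import Mathlib.Data.Finset.Card
import Mathlib.Data.Finset.Powerset
import HarnessLib

/-!
# Partial bijections and complete systems (Krajíček–Pudlák–Woods)

Topic `Literature/Computability/MetaComplexity`. The combinatorial core of the
Krajíček–Pudlák–Woods / Pitassi–Beame–Impagliazzo exponential lower bound for bounded-depth
Frege proofs of the pigeonhole principle, in the "complete systems of partial bijections"
formulation of Krajíček, *Bounded arithmetic, propositional logic, and complexity theory*
(1995), §12.3 (which presents Krajíček–Pudlák–Woods 1995, §2–3):

* `PBij.IsPMatching σ`: a finite set of pairs `σ ⊆ α × β` is a partial bijection (partial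
  1–1 map; we say *matching*); `PBij.Compat σ τ` (`σ ∪ τ` is again a matching, "`σ ∪ τ ∈ 𝓜`");
  `PBij.dom`, `PBij.rng`.
* `PBij.IsKComplete D R k S` (Def. 12.3.1): `S` is a `k`-complete system of matchings inside
  the universe `D × R` (`|R| = n`): elements pairwise incompatible, of norm `≤ k`, and every
  matching `γ` with `|γ| + k ≤ n` is compatible with some element of `S`.
* `PBij.Refines H S` (`H ◁ S`), `PBij.proj S H` (`S(H)`), `PBij.crefine S T` (`S × T`)
  (Def. 12.3.3) and `PBij.restrict ρ H` (`H^ρ`, Def. 12.3.8).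
* Lemmas 12.3.2 (the `2`-complete system of an atom `p_{ij}`, `PBij.atomSystem`), 12.3.4
  (`Refines.trans`), 12.3.5 (`isKComplete_crefine`, `refines_crefine_left/right`), 12.3.6
  (`proj_proj`, `proj_self`, `proj_eq_self_iff`), 12.3.7 (`proj_union`, `disjoint_proj`,
  `proj_sdiff`) and 12.3.9 (`Refines.restrict`, `IsKComplete.restrict`, `restrict_proj`).

All statements are fully proved; they serve the `k`-evaluation machinery and the PHP
switching lemma of the same development (towards Krajíček 1995, Thm. 12.5.3).

## References

* J. Krajíček, *Bounded arithmetic, propositional logic, and complexity theory*, CUP 1995,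
  §12.3, Def. 12.3.1, Lemma 12.3.2, Def. 12.3.3, Lemmas 12.3.4–12.3.7, Def. 12.3.8, Lemma 12.3.9
  [Krajicek1995].
* J. Krajíček, P. Pudlák, A. Woods, *An exponential lower bound to the size of bounded depth
  Frege proofs of the pigeonhole principle*, Random Structures Algorithms 7 (1995) 15–39
  [KrajicekPudlakWoods1995].
* J. Krajíček, *Proof complexity*, CUP 2019, §15.1 (the same lemmas phrased with PHP-trees)
  [Krajicek2019].

## Design choices

* Matchings are plain `Finset (α × β)` with the predicate `IsPMatching` (decidable), so that
  unions, differences and cardinalities are Mathlib's; the universe `D ×ˢ R` is carried by the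
  predicates (`IsKComplete.subset`), not by the type, because restrictions shrink it.
* Completeness is stated as `γ.card + k ≤ R.card → …` (no natural-number subtraction); for
  `k ≤ R.card` this is Krajíček's `|γ| ≤ n - k`.
* We use complete systems (Krajíček 1995, KPW 1995) rather than the PHP-trees of
  Pitassi–Beame–Impagliazzo / Krajíček 2019: only the completeness property of trees
  (Krajíček 2019, Lemma 15.1.1) is ever used, and it is the defining axiom here.
-/

namespace Literature.Computability.MetaComplexity.PBij

variable {α β : Type*} [DecidableEq α] [DecidableEq β]

/-! ### Matchings, compatibility, domain and range -/

/-- `σ` is a partial bijection (partial injective map, *matching*): two distinct pairs of `σ`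
share neither their first nor their second coordinate. [cite: Krajicek1995, §12.3 (the set 𝓜 of partial 1–1 maps)] -/
def IsPMatching (σ : Finset (α × β)) : Prop :=
  ∀ p ∈ σ, ∀ q ∈ σ, (p.1 = q.1 ∨ p.2 = q.2) → p = q

/-- Being a matching is decidable (a finite conjunction). [folklore] -/
instance (σ : Finset (α × β)) : Decidable (IsPMatching σ) := by
  unfold IsPMatching; infer_instance

/-- Two matchings are *compatible* if their union is a matching (`σ ∪ τ ∈ 𝓜`).
[cite: Krajicek1995, Def. 12.3.1] -/
def Compat (σ τ : Finset (α × β)) : Prop :=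
  IsPMatching (σ ∪ τ)

/-- Compatibility is decidable. [folklore] -/
instance (σ τ : Finset (α × β)) : Decidable (Compat σ τ) := by
  unfold Compat; infer_instance

/-- The domain of a set of pairs. [cite: Krajicek1995, §12.3] -/
def dom (σ : Finset (α × β)) : Finset α :=
  σ.image Prod.fst

/-- The range of a set of pairs. [cite: Krajicek1995, §12.3] -/
def rng (σ : Finset (α × β)) : Finset β :=
  σ.image Prod.snd

omit [DecidableEq α] [DecidableEq β] in
/-- A subset of a matching is a matching. [folklore] -/
theorem IsPMatching.subset {σ τ : Finset (α × β)} (h : IsPMatching τ) (hst : σ ⊆ τ) :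
    IsPMatching σ :=
  fun p hp q hq hpq => h p (hst hp) q (hst hq) hpq

omit [DecidableEq α] [DecidableEq β] in
/-- The empty set is a matching. [folklore] -/
theorem IsPMatching.empty : IsPMatching (∅ : Finset (α × β)) :=
  fun p hp => absurd hp (Finset.notMem_empty p)

omit [DecidableEq α] [DecidableEq β] in
/-- A single pair is a matching. [folklore] -/
theorem IsPMatching.singleton (p : α × β) : IsPMatching ({p} : Finset (α × β)) := by
  intro a ha b hb _
  rw [Finset.mem_singleton] at ha hb
  rw [ha, hb]

/-- Compatibility, unfolded: both are matchings and pairs across them that share a coordinate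
are equal. [folklore] -/
theorem compat_iff {σ τ : Finset (α × β)} :
    Compat σ τ ↔ IsPMatching σ ∧ IsPMatching τ ∧
      ∀ p ∈ σ, ∀ q ∈ τ, (p.1 = q.1 ∨ p.2 = q.2) → p = q := by
  constructor
  · intro h
    refine ⟨h.subset Finset.subset_union_left, h.subset Finset.subset_union_right,
      fun p hp q hq hpq => h p (Finset.mem_union_left _ hp) q (Finset.mem_union_right _ hq) hpq⟩
  · rintro ⟨hσ, hτ, hx⟩ p hp q hq hpq
    rw [Finset.mem_union] at hp hq
    rcases hp with hp | hp <;> rcases hq with hq | hq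
    · exact hσ p hp q hq hpq
    · exact hx p hp q hq hpq
    · exact (hx q hq p hp (hpq.imp Eq.symm Eq.symm)).symm
    · exact hτ p hp q hq hpq

/-- Compatibility is symmetric. [folklore] -/
theorem Compat.symm {σ τ : Finset (α × β)} (h : Compat σ τ) : Compat τ σ := by
  unfold Compat at h ⊢; rwa [Finset.union_comm]

/-- Compatibility is symmetric (iff form). [folklore] -/
theorem compat_comm {σ τ : Finset (α × β)} : Compat σ τ ↔ Compat τ σ :=
  ⟨Compat.symm, Compat.symm⟩

/-- Compatible sets are matchings (left). [folklore] -/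
theorem Compat.left {σ τ : Finset (α × β)} (h : Compat σ τ) : IsPMatching σ :=
  (compat_iff.1 h).1

/-- Compatible sets are matchings (right). [folklore] -/
theorem Compat.right {σ τ : Finset (α × β)} (h : Compat σ τ) : IsPMatching τ :=
  (compat_iff.1 h).2.1

/-- Compatibility is inherited by subsets (left argument). [folklore] -/
theorem Compat.mono_left {σ σ' τ : Finset (α × β)} (h : Compat σ τ) (hs : σ' ⊆ σ) :
    Compat σ' τ :=
  IsPMatching.subset h (Finset.union_subset_union hs le_rfl)

/-- Compatibility is inherited by subsets (right argument). [folklore] -/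
theorem Compat.mono_right {σ τ τ' : Finset (α × β)} (h : Compat σ τ) (ht : τ' ⊆ τ) :
    Compat σ τ' :=
  IsPMatching.subset h (Finset.union_subset_union le_rfl ht)

/-- A matching is compatible with each of its subsets. [folklore] -/
theorem IsPMatching.compat_of_subset {σ τ : Finset (α × β)} (h : IsPMatching τ) (hst : σ ⊆ τ) :
    Compat σ τ := by
  unfold Compat; rwa [Finset.union_eq_right.2 hst]

/-- A matching is compatible with itself. [folklore] -/
theorem IsPMatching.compat_self {σ : Finset (α × β)} (h : IsPMatching σ) : Compat σ σ :=
  h.compat_of_subset le_rfl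

/-- Everything (that is a matching) is compatible with the empty matching. [folklore] -/
theorem IsPMatching.compat_empty {σ : Finset (α × β)} (h : IsPMatching σ) : Compat ∅ σ := by
  unfold Compat; rwa [Finset.empty_union]

/-- Two subsets of one matching are compatible. [folklore] -/
theorem IsPMatching.compat_of_subset_of_subset {σ τ υ : Finset (α × β)} (h : IsPMatching υ)
    (hs : σ ⊆ υ) (ht : τ ⊆ υ) : Compat σ τ :=
  h.subset (Finset.union_subset hs ht)

/-- The union of two compatible matchings is compatible with a third matching iff both are,
provided the third is compatible with each (pairwise compatibility suffices for matchings).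
[folklore] -/
theorem compat_union_left {σ τ υ : Finset (α × β)} (h₁ : Compat σ υ) (h₂ : Compat τ υ)
    (h₃ : Compat σ τ) : Compat (σ ∪ τ) υ := by
  rw [compat_iff] at h₁ h₂ ⊢
  refine ⟨h₃, h₁.2.1, fun p hp q hq hpq => ?_⟩
  rw [Finset.mem_union] at hp
  rcases hp with hp | hp
  · exact h₁.2.2 p hp q hq hpq
  · exact h₂.2.2 p hp q hq hpq

omit [DecidableEq β] in
/-- Membership in the domain. [folklore] -/
@[simp] theorem mem_dom {σ : Finset (α × β)} {a : α} : a ∈ dom σ ↔ ∃ b, (a, b) ∈ σ := by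
  simp [dom]

omit [DecidableEq α] in
/-- Membership in the range. [folklore] -/
@[simp] theorem mem_rng {σ : Finset (α × β)} {b : β} : b ∈ rng σ ↔ ∃ a, (a, b) ∈ σ := by
  simp [rng]

/-- The domain of a union. [folklore] -/
@[simp] theorem dom_union (σ τ : Finset (α × β)) : dom (σ ∪ τ) = dom σ ∪ dom τ :=
  Finset.image_union _ _

/-- The range of a union. [folklore] -/
@[simp] theorem rng_union (σ τ : Finset (α × β)) : rng (σ ∪ τ) = rng σ ∪ rng τ :=
  Finset.image_union _ _

omit [DecidableEq β] in
/-- The domain of the empty matching. [folklore] -/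
@[simp] theorem dom_empty : dom (∅ : Finset (α × β)) = ∅ := rfl

omit [DecidableEq α] in
/-- The range of the empty matching. [folklore] -/
@[simp] theorem rng_empty : rng (∅ : Finset (α × β)) = ∅ := rfl

omit [DecidableEq β] in
/-- The domain is monotone. [folklore] -/
theorem dom_mono {σ τ : Finset (α × β)} (h : σ ⊆ τ) : dom σ ⊆ dom τ :=
  Finset.image_subset_image h

omit [DecidableEq α] in
/-- The range is monotone. [folklore] -/
theorem rng_mono {σ τ : Finset (α × β)} (h : σ ⊆ τ) : rng σ ⊆ rng τ :=
  Finset.image_subset_image h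

omit [DecidableEq α] [DecidableEq β] in
/-- A matching is determined on its domain: the second coordinate is a function of the first.
[folklore] -/
theorem IsPMatching.eq_of_fst_eq {σ : Finset (α × β)} (h : IsPMatching σ) {a : α} {b b' : β}
    (hb : (a, b) ∈ σ) (hb' : (a, b') ∈ σ) : b = b' := by
  exact (Prod.mk.inj (h _ hb _ hb' (Or.inl rfl))).2

omit [DecidableEq α] [DecidableEq β] in
/-- A matching is injective: the first coordinate is a function of the second. [folklore] -/
theorem IsPMatching.eq_of_snd_eq {σ : Finset (α × β)} (h : IsPMatching σ) {a a' : α} {b : β}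
    (ha : (a, b) ∈ σ) (ha' : (a', b) ∈ σ) : a = a' := by
  exact (Prod.mk.inj (h _ ha _ ha' (Or.inr rfl))).1

omit [DecidableEq β] in
/-- The domain of a matching has the same cardinality as the matching. [cite: Krajicek1995, §12.3 (|α| = |dom α| = |rng α|)] -/
theorem IsPMatching.card_dom {σ : Finset (α × β)} (h : IsPMatching σ) : (dom σ).card = σ.card :=
  Finset.card_image_of_injOn fun p hp q hq hpq => h p hp q hq (Or.inl hpq)

omit [DecidableEq α] in
/-- The range of a matching has the same cardinality as the matching. [cite: Krajicek1995, §12.3 (|α| = |dom α| = |rng α|)] -/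
theorem IsPMatching.card_rng {σ : Finset (α × β)} (h : IsPMatching σ) : (rng σ).card = σ.card :=
  Finset.card_image_of_injOn fun p hp q hq hpq => h p hp q hq (Or.inr hpq)

omit [DecidableEq β] in
/-- A set of pairs inside `D ×ˢ R` has its domain in `D`. [folklore] -/
theorem dom_subset_of_subset_product {σ : Finset (α × β)} {D : Finset α} {R : Finset β}
    (h : σ ⊆ D ×ˢ R) : dom σ ⊆ D := by
  intro a ha
  obtain ⟨b, hb⟩ := mem_dom.1 ha
  exact (Finset.mem_product.1 (h hb)).1

omit [DecidableEq α] in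
/-- A set of pairs inside `D ×ˢ R` has its range in `R`. [folklore] -/
theorem rng_subset_of_subset_product {σ : Finset (α × β)} {D : Finset α} {R : Finset β}
    (h : σ ⊆ D ×ˢ R) : rng σ ⊆ R := by
  intro b hb
  obtain ⟨a, ha⟩ := mem_rng.1 hb
  exact (Finset.mem_product.1 (h ha)).2

omit [DecidableEq α] in
/-- The cardinality of a matching inside `D ×ˢ R` is at most `|R|`. [folklore] -/
theorem IsPMatching.card_le_card_right {σ : Finset (α × β)} {D : Finset α} {R : Finset β}
    (h : IsPMatching σ) (hs : σ ⊆ D ×ˢ R) : σ.card ≤ R.card := by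
  rw [← h.card_rng]; exact Finset.card_le_card (rng_subset_of_subset_product hs)

omit [DecidableEq β] in
/-- The cardinality of a matching inside `D ×ˢ R` is at most `|D|`. [folklore] -/
theorem IsPMatching.card_le_card_left {σ : Finset (α × β)} {D : Finset α} {R : Finset β}
    (h : IsPMatching σ) (hs : σ ⊆ D ×ˢ R) : σ.card ≤ D.card := by
  rw [← h.card_dom]; exact Finset.card_le_card (dom_subset_of_subset_product hs)

/-- Adding a pair with fresh coordinates to a matching gives a matching. [folklore] -/
theorem IsPMatching.insert {σ : Finset (α × β)} (h : IsPMatching σ) {a : α} {b : β}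
    (ha : a ∉ dom σ) (hb : b ∉ rng σ) : IsPMatching (insert (a, b) σ) := by
  rintro ⟨pa, pb⟩ hp ⟨qa, qb⟩ hq hpq
  simp only [Finset.mem_insert, Prod.mk.injEq] at hp hq hpq ⊢
  rcases hp with ⟨rfl, rfl⟩ | hp <;> rcases hq with ⟨rfl, rfl⟩ | hq
  · exact ⟨rfl, rfl⟩
  · rcases hpq with rfl | rfl
    · exact (ha (mem_dom.2 ⟨qb, hq⟩)).elim
    · exact (hb (mem_rng.2 ⟨qa, hq⟩)).elim
  · rcases hpq with rfl | rfl
    · exact (ha (mem_dom.2 ⟨pb, hp⟩)).elim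
    · exact (hb (mem_rng.2 ⟨pa, hp⟩)).elim
  · exact Prod.mk.inj (h _ hp _ hq hpq)

/-- A pair with fresh coordinates is compatible with a matching. [folklore] -/
theorem IsPMatching.compat_singleton_of_fresh {σ : Finset (α × β)} (h : IsPMatching σ) {a : α}
    {b : β} (ha : a ∉ dom σ) (hb : b ∉ rng σ) : Compat {(a, b)} σ := by
  unfold Compat
  rw [Finset.singleton_union]
  exact h.insert ha hb

/-- A pair already in a matching is compatible with it. [folklore] -/
theorem IsPMatching.compat_singleton_of_mem {σ : Finset (α × β)} (h : IsPMatching σ) {p : α × β}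
    (hp : p ∈ σ) : Compat {p} σ :=
  h.compat_of_subset (Finset.singleton_subset_iff.2 hp)

/-- If `{(a, b)}` is compatible with a matching `σ` and `a ∈ dom σ`, then `(a, b) ∈ σ`.
[folklore] -/
theorem Compat.mem_of_mem_dom {σ : Finset (α × β)} {a : α} {b : β} (h : Compat {(a, b)} σ)
    (ha : a ∈ dom σ) : (a, b) ∈ σ := by
  obtain ⟨b', hb'⟩ := mem_dom.1 ha
  have := (compat_iff.1 h).2.2 (a, b) (Finset.mem_singleton_self _) (a, b') hb' (Or.inl rfl)
  rw [this]; exact hb'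

/-- If `{(a, b)}` is compatible with a matching `σ` and `b ∈ rng σ`, then `(a, b) ∈ σ`.
[folklore] -/
theorem Compat.mem_of_mem_rng {σ : Finset (α × β)} {a : α} {b : β} (h : Compat {(a, b)} σ)
    (hb : b ∈ rng σ) : (a, b) ∈ σ := by
  obtain ⟨a', ha'⟩ := mem_rng.1 hb
  have := (compat_iff.1 h).2.2 (a, b) (Finset.mem_singleton_self _) (a', b) ha' (Or.inr rfl)
  rw [this]; exact ha'

/-- A pair of a matching compatible with `σ` whose first coordinate is in `dom σ` lies in `σ`.
[folklore] -/
theorem Compat.mem_of_mem_of_mem_dom {σ τ : Finset (α × β)} (h : Compat τ σ) {p : α × β}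
    (hp : p ∈ τ) (ha : p.1 ∈ dom σ) : p ∈ σ :=
  Compat.mem_of_mem_dom (h.mono_left (Finset.singleton_subset_iff.2 hp)) ha

/-- A pair of a matching compatible with `σ` whose second coordinate is in `rng σ` lies in `σ`.
[folklore] -/
theorem Compat.mem_of_mem_of_mem_rng {σ τ : Finset (α × β)} (h : Compat τ σ) {p : α × β}
    (hp : p ∈ τ) (hb : p.2 ∈ rng σ) : p ∈ σ :=
  Compat.mem_of_mem_rng (h.mono_left (Finset.singleton_subset_iff.2 hp)) hb

/-! ### Complete systems, refinement, projection, common refinement -/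

/-- **`k`-complete systems** (Krajíček 1995, Def. 12.3.1(b); Krajíček–Pudlák–Woods 1995).
A finite set `S` of matchings inside the universe `D × R` (with `n = |R|` holes) is
`k`-complete if (1) distinct elements are incompatible, (2) every matching `γ` in the universe
with `|γ| + k ≤ n` (i.e. `|γ| ≤ n - k`) is compatible with some element of `S`, and (3) every
element has norm (size) at most `k`. [cite: Krajicek1995, Def. 12.3.1] -/
structure IsKComplete (D : Finset α) (R : Finset β) (k : ℕ) (S : Finset (Finset (α × β))) :
    Prop where
  /-- elements are matchings -/
  isPMatching : ∀ σ ∈ S, IsPMatching σ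
  /-- elements live in the universe `D × R` -/
  subset : ∀ σ ∈ S, σ ⊆ D ×ˢ R
  /-- (3) norms are at most `k` -/
  card_le : ∀ σ ∈ S, σ.card ≤ k
  /-- (1) distinct elements are incompatible -/
  eq_of_compat : ∀ σ ∈ S, ∀ τ ∈ S, Compat σ τ → σ = τ
  /-- (2) completeness: every small matching of the universe is compatible with an element -/
  exists_compat : ∀ γ : Finset (α × β), IsPMatching γ → γ ⊆ D ×ˢ R → γ.card + k ≤ R.card →
    ∃ σ ∈ S, Compat σ γ

/-- `H ◁ S`: `S` *refines* `H` — every element of `S` compatible with some element of `H`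
contains an element of `H`. [cite: Krajicek1995, Def. 12.3.3(1)] -/
def Refines (H S : Finset (Finset (α × β))) : Prop :=
  ∀ σ ∈ S, (∃ γ ∈ H, Compat γ σ) → ∃ γ ∈ H, γ ⊆ σ

/-- The *projection* `S(H)` of `H` on `S`: the elements of `S` containing an element of `H`.
[cite: Krajicek1995, Def. 12.3.3(3)] -/
def proj (S H : Finset (Finset (α × β))) : Finset (Finset (α × β)) :=
  S.filter fun σ => ∃ γ ∈ H, γ ⊆ σ

/-- The *common refinement* `S × T := {σ ∪ τ ∈ 𝓜 | σ ∈ S, τ ∈ T}` (unions of compatible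
pairs). [cite: Krajicek1995, Def. 12.3.3(2)] -/
def crefine (S T : Finset (Finset (α × β))) : Finset (Finset (α × β)) :=
  ((S ×ˢ T).filter fun p => Compat p.1 p.2).image fun p => p.1 ∪ p.2

/-- Membership in a projection. [cite: Krajicek1995, Def. 12.3.3(3)] -/
@[simp] theorem mem_proj {S H : Finset (Finset (α × β))} {σ : Finset (α × β)} :
    σ ∈ proj S H ↔ σ ∈ S ∧ ∃ γ ∈ H, γ ⊆ σ := by
  simp [proj]

/-- Membership in a common refinement. [cite: Krajicek1995, Def. 12.3.3(2)] -/
theorem mem_crefine {S T : Finset (Finset (α × β))} {υ : Finset (α × β)} :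
    υ ∈ crefine S T ↔ ∃ σ ∈ S, ∃ τ ∈ T, Compat σ τ ∧ σ ∪ τ = υ := by
  simp only [crefine, Finset.mem_image, Finset.mem_filter, Finset.mem_product, Prod.exists]
  constructor
  · rintro ⟨σ, τ, ⟨⟨hσ, hτ⟩, hc⟩, rfl⟩; exact ⟨σ, hσ, τ, hτ, hc, rfl⟩
  · rintro ⟨σ, hσ, τ, hτ, hc, rfl⟩; exact ⟨σ, τ, ⟨⟨hσ, hτ⟩, hc⟩, rfl⟩

/-- A projection is a subset of the system. [folklore] -/
theorem proj_subset (S H : Finset (Finset (α × β))) : proj S H ⊆ S :=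
  Finset.filter_subset _ _

/-- Projection is monotone in the projected set. [cite: Krajicek1995, Lemma 12.3.7(1)] -/
theorem proj_mono {S H H' : Finset (Finset (α × β))} (h : H ⊆ H') : proj S H ⊆ proj S H' := by
  intro σ hσ
  rw [mem_proj] at hσ ⊢
  obtain ⟨hS, γ, hγ, hγσ⟩ := hσ
  exact ⟨hS, γ, h hγ, hγσ⟩

/-- Completeness is monotone in `k`. [folklore] -/
theorem IsKComplete.mono {D : Finset α} {R : Finset β} {k k' : ℕ} {S : Finset (Finset (α × β))}
    (h : IsKComplete D R k S) (hk : k ≤ k') : IsKComplete D R k' S where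
  isPMatching := h.isPMatching
  subset := h.subset
  card_le σ hσ := (h.card_le σ hσ).trans hk
  eq_of_compat := h.eq_of_compat
  exists_compat γ hγ hγs hc := h.exists_compat γ hγ hγs (by omega)

/-- A complete system with `k ≤ n` is nonempty (apply completeness to `γ = ∅`).
[cite: Krajicek1995, Def. 12.3.1 (remark: S ≠ ∅)] -/
theorem IsKComplete.nonempty {D : Finset α} {R : Finset β} {k : ℕ} {S : Finset (Finset (α × β))}
    (h : IsKComplete D R k S) (hk : k ≤ R.card) : S.Nonempty := by
  obtain ⟨σ, hσ, -⟩ := h.exists_compat ∅ IsPMatching.empty (Finset.empty_subset _) (by simpa)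
  exact ⟨σ, hσ⟩

/-- A subset of a system of pairwise incompatible matchings is refined by the system
(`H ⊆ S ⟹ H ◁ S`). [cite: Krajicek1995, §12.4 (proof of Lemma 12.4.4, last step)] -/
theorem refines_of_subset {D : Finset α} {R : Finset β} {k : ℕ} {H S : Finset (Finset (α × β))}
    (hS : IsKComplete D R k S) (hHS : H ⊆ S) : Refines H S := by
  rintro σ hσ ⟨γ, hγ, hc⟩
  exact ⟨γ, hγ, (hS.eq_of_compat γ (hHS hγ) σ hσ hc).le⟩

/-- The projection of a subset `H ⊆ S` of a system onto `S` is `H` itself. [folklore] -/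
theorem proj_eq_of_subset {D : Finset α} {R : Finset β} {k : ℕ} {H S : Finset (Finset (α × β))}
    (hS : IsKComplete D R k S) (hHS : H ⊆ S) : proj S H = H := by
  ext σ
  rw [mem_proj]
  constructor
  · rintro ⟨hσ, γ, hγ, hγσ⟩
    have := hS.eq_of_compat γ (hHS hγ) σ hσ ((hS.isPMatching σ hσ).compat_of_subset hγσ)
    rwa [← this]
  · intro hσ; exact ⟨hHS hσ, σ, hσ, le_rfl⟩

/-- Key consequence of `S ◁ T` for complete systems (Krajíček 1995, (∗) in the proof of
Lemma 12.3.4): if `S` is `k`-complete, `T` is `ℓ`-complete and `k + ℓ ≤ n`, then every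
element of `T` *contains* an element of `S`. [cite: Krajicek1995, Lemma 12.3.4 (∗)] -/
theorem Refines.exists_subset {D : Finset α} {R : Finset β} {k ℓ : ℕ}
    {S T : Finset (Finset (α × β))} (hST : Refines S T) (hS : IsKComplete D R k S)
    (hT : IsKComplete D R ℓ T) (hkl : k + ℓ ≤ R.card) {τ : Finset (α × β)} (hτ : τ ∈ T) :
    ∃ σ ∈ S, σ ⊆ τ := by
  obtain ⟨σ, hσ, hc⟩ := hS.exists_compat τ (hT.isPMatching τ hτ) (hT.subset τ hτ)
    (by have := hT.card_le τ hτ; omega)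
  exact hST τ hτ ⟨σ, hσ, hc⟩

/-- **Lemma 12.3.4** (transitivity of refinement through a complete system): if
`H ◁ S ◁ T`, `S` is `k`-complete, `T` is `ℓ`-complete and `k + ℓ ≤ n`, then `H ◁ T`.
[cite: Krajicek1995, Lemma 12.3.4] -/
theorem Refines.trans {D : Finset α} {R : Finset β} {k ℓ : ℕ}
    {H S T : Finset (Finset (α × β))} (hHS : Refines H S) (hST : Refines S T)
    (hS : IsKComplete D R k S) (hT : IsKComplete D R ℓ T) (hkl : k + ℓ ≤ R.card) :
    Refines H T := by
  rintro τ hτ ⟨γ, hγ, hc⟩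
  obtain ⟨σ, hσ, hστ⟩ := hST.exists_subset hS hT hkl hτ
  obtain ⟨γ', hγ', hγ'σ⟩ := hHS σ hσ ⟨γ, hγ, hc.mono_right hστ⟩
  exact ⟨γ', hγ', hγ'σ.trans hστ⟩

/-- **Lemma 12.3.5(1)**: a system of pairwise incompatible matchings is refined by its common
refinement with anything, `S ◁ S × T`. [cite: Krajicek1995, Lemma 12.3.5(1)] -/
theorem refines_crefine_left {D : Finset α} {R : Finset β} {k : ℕ}
    {S T : Finset (Finset (α × β))} (hS : IsKComplete D R k S) : Refines S (crefine S T) := by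
  rintro υ hυ ⟨γ, hγ, hc⟩
  obtain ⟨σ, hσ, τ, _, _, rfl⟩ := mem_crefine.1 hυ
  have : γ = σ := hS.eq_of_compat γ hγ σ hσ (hc.mono_right Finset.subset_union_left)
  exact ⟨γ, hγ, this ▸ Finset.subset_union_left⟩

/-- **Lemma 12.3.5(1)**, right factor: `T ◁ S × T`. [cite: Krajicek1995, Lemma 12.3.5(1)] -/
theorem refines_crefine_right {D : Finset α} {R : Finset β} {ℓ : ℕ}
    {S T : Finset (Finset (α × β))} (hT : IsKComplete D R ℓ T) : Refines T (crefine S T) := by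
  rintro υ hυ ⟨γ, hγ, hc⟩
  obtain ⟨σ, _, τ, hτ, _, rfl⟩ := mem_crefine.1 hυ
  have : γ = τ := hT.eq_of_compat γ hγ τ hτ (hc.mono_right Finset.subset_union_right)
  exact ⟨γ, hγ, this ▸ Finset.subset_union_right⟩

/-- **Lemma 12.3.5(2)**: the common refinement of a `k`-complete and an `ℓ`-complete system
is `(k + ℓ)`-complete (Krajíček assumes `k + ℓ ≤ n`, which is not needed with our phrasing
of completeness). [cite: Krajicek1995, Lemma 12.3.5(2)] -/
theorem isKComplete_crefine {D : Finset α} {R : Finset β} {k ℓ : ℕ}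
    {S T : Finset (Finset (α × β))} (hS : IsKComplete D R k S) (hT : IsKComplete D R ℓ T) :
    IsKComplete D R (k + ℓ) (crefine S T) where
  isPMatching υ hυ := by
    obtain ⟨σ, _, τ, _, hc, rfl⟩ := mem_crefine.1 hυ
    exact hc
  subset υ hυ := by
    obtain ⟨σ, hσ, τ, hτ, _, rfl⟩ := mem_crefine.1 hυ
    exact Finset.union_subset (hS.subset σ hσ) (hT.subset τ hτ)
  card_le υ hυ := by
    obtain ⟨σ, hσ, τ, hτ, _, rfl⟩ := mem_crefine.1 hυ
    exact (Finset.card_union_le _ _).trans (Nat.add_le_add (hS.card_le σ hσ) (hT.card_le τ hτ))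
  eq_of_compat υ hυ υ' hυ' hc := by
    obtain ⟨σ, hσ, τ, hτ, _, rfl⟩ := mem_crefine.1 hυ
    obtain ⟨σ', hσ', τ', hτ', _, rfl⟩ := mem_crefine.1 hυ'
    have h1 : σ = σ' := hS.eq_of_compat σ hσ σ' hσ'
      ((hc.mono_left Finset.subset_union_left).mono_right Finset.subset_union_left)
    have h2 : τ = τ' := hT.eq_of_compat τ hτ τ' hτ'
      ((hc.mono_left Finset.subset_union_right).mono_right Finset.subset_union_right)
    rw [h1, h2]
  exists_compat γ hγ hγs hcard := by
    obtain ⟨σ, hσ, hσγ⟩ := hS.exists_compat γ hγ hγs (by omega)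
    have hσγs : σ ∪ γ ⊆ D ×ˢ R := Finset.union_subset (hS.subset σ hσ) hγs
    have hcard' : (σ ∪ γ).card + ℓ ≤ R.card :=
      calc (σ ∪ γ).card + ℓ ≤ (σ.card + γ.card) + ℓ :=
            Nat.add_le_add_right (Finset.card_union_le _ _) _
        _ ≤ (k + γ.card) + ℓ := by have := hS.card_le σ hσ; omega
        _ ≤ R.card := by omega
    obtain ⟨τ, hτ, hτσγ⟩ := hT.exists_compat (σ ∪ γ) hσγ hσγs hcard'
    have hστ : Compat σ τ := (hτσγ.mono_right Finset.subset_union_left).symm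
    refine ⟨σ ∪ τ, mem_crefine.2 ⟨σ, hσ, τ, hτ, hστ, rfl⟩, ?_⟩
    exact compat_union_left hσγ (hτσγ.mono_right Finset.subset_union_right) hστ

/-- **Lemma 12.3.6**, first part: for `H ◁ S ◁ T` with `S` `k`-complete, `T` `ℓ`-complete and
`k + ℓ ≤ n`, projecting through `S` loses nothing: `T(S(H)) = T(H)`.
[cite: Krajicek1995, Lemma 12.3.6] -/
theorem proj_proj {D : Finset α} {R : Finset β} {k ℓ : ℕ} {H S T : Finset (Finset (α × β))}
    (hHS : Refines H S) (hST : Refines S T) (hS : IsKComplete D R k S)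
    (hT : IsKComplete D R ℓ T) (hkl : k + ℓ ≤ R.card) : proj T (proj S H) = proj T H := by
  ext τ
  simp only [mem_proj]
  constructor
  · rintro ⟨hτ, σ, ⟨_, γ, hγ, hγσ⟩, hστ⟩
    exact ⟨hτ, γ, hγ, hγσ.trans hστ⟩
  · rintro ⟨hτ, γ, hγ, hγτ⟩
    obtain ⟨σ, hσ, hστ⟩ := hST.exists_subset hS hT hkl hτ
    have hc : Compat γ σ :=
      (hT.isPMatching τ hτ).compat_of_subset_of_subset hγτ hστ
    obtain ⟨γ', hγ', hγ'σ⟩ := hHS σ hσ ⟨γ, hγ, hc⟩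
    exact ⟨hτ, σ, ⟨hσ, γ', hγ', hγ'σ⟩, hστ⟩

/-- **Lemma 12.3.6**, second part: `T(S) = T` for `S ◁ T` complete with `k + ℓ ≤ n`.
[cite: Krajicek1995, Lemma 12.3.6] -/
theorem proj_self {D : Finset α} {R : Finset β} {k ℓ : ℕ} {S T : Finset (Finset (α × β))}
    (hST : Refines S T) (hS : IsKComplete D R k S) (hT : IsKComplete D R ℓ T)
    (hkl : k + ℓ ≤ R.card) : proj T S = T := by
  ext τ
  rw [mem_proj]
  exact ⟨fun h => h.1, fun hτ => ⟨hτ, hST.exists_subset hS hT hkl hτ⟩⟩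

/-- **Lemma 12.3.6**, third part: for `H ◁ S ◁ T` as above, `S(H) = S ↔ T(H) = T`
("`H` is true in `S` iff it is true in the finer `T`"). [cite: Krajicek1995, Lemma 12.3.6] -/
theorem proj_eq_self_iff {D : Finset α} {R : Finset β} {k ℓ : ℕ}
    {H S T : Finset (Finset (α × β))} (hHS : Refines H S) (hST : Refines S T)
    (hS : IsKComplete D R k S) (hT : IsKComplete D R ℓ T) (hkl : k + ℓ ≤ R.card) :
    proj S H = S ↔ proj T H = T := by
  constructor
  · intro h
    rw [← proj_proj hHS hST hS hT hkl, h, proj_self hST hS hT hkl]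
  · intro h
    ext σ
    rw [mem_proj]
    refine ⟨fun h' => h'.1, fun hσ => ⟨hσ, ?_⟩⟩
    obtain ⟨τ, hτ, hτσ⟩ := hT.exists_compat σ (hS.isPMatching σ hσ) (hS.subset σ hσ)
      (by have := hS.card_le σ hσ; omega)
    have hτ' : τ ∈ proj T H := by rw [h]; exact hτ
    obtain ⟨-, γ, hγ, hγτ⟩ := mem_proj.1 hτ'
    exact hHS σ hσ ⟨γ, hγ, hτσ.mono_left hγτ⟩

/-- **Lemma 12.3.7(1)**: projection commutes with binary unions.
[cite: Krajicek1995, Lemma 12.3.7(1)] -/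
theorem proj_union (S H₁ H₂ : Finset (Finset (α × β))) :
    proj S (H₁ ∪ H₂) = proj S H₁ ∪ proj S H₂ := by
  ext σ
  simp only [mem_proj, Finset.mem_union]
  constructor
  · rintro ⟨hσ, γ, hγ | hγ, hγσ⟩
    · exact Or.inl ⟨hσ, γ, hγ, hγσ⟩
    · exact Or.inr ⟨hσ, γ, hγ, hγσ⟩
  · rintro (⟨hσ, γ, hγ, hγσ⟩ | ⟨hσ, γ, hγ, hγσ⟩)
    · exact ⟨hσ, γ, Or.inl hγ, hγσ⟩
    · exact ⟨hσ, γ, Or.inr hγ, hγσ⟩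

/-- Projection of the empty set is empty. [cite: Krajicek1995, Lemma 12.3.7(1)] -/
@[simp] theorem proj_empty (S : Finset (Finset (α × β))) : proj S ∅ = ∅ := by
  ext σ; simp [mem_proj]

/-- Projection commutes with indexed unions (`Finset.biUnion`).
[cite: Krajicek1995, Lemma 12.3.7(1)] -/
theorem proj_biUnion {ι : Type*} [DecidableEq ι] (S : Finset (Finset (α × β))) (I : Finset ι)
    (H : ι → Finset (Finset (α × β))) : proj S (I.biUnion H) = I.biUnion fun i => proj S (H i) := by
  ext σ
  simp only [mem_proj, Finset.mem_biUnion]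
  constructor
  · rintro ⟨hσ, γ, ⟨i, hi, hγ⟩, hγσ⟩; exact ⟨i, hi, hσ, γ, hγ, hγσ⟩
  · rintro ⟨i, hi, hσ, γ, hγ, hγσ⟩; exact ⟨hσ, γ, ⟨i, hi, hγ⟩, hγσ⟩

/-- **Lemma 12.3.7(2)**: projections (onto matchings) of disjoint subsets of a system of
pairwise incompatible matchings are disjoint. [cite: Krajicek1995, Lemma 12.3.7(2)] -/
theorem disjoint_proj {D : Finset α} {R : Finset β} {k : ℕ} {S S₀ S₁ T : Finset (Finset (α × β))}
    (hS : IsKComplete D R k S) (h₀ : S₀ ⊆ S) (h₁ : S₁ ⊆ S) (hd : Disjoint S₀ S₁)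
    (hT : ∀ τ ∈ T, IsPMatching τ) : Disjoint (proj T S₀) (proj T S₁) := by
  rw [Finset.disjoint_left]
  intro τ hτ₀ hτ₁
  obtain ⟨hτ, γ₀, hγ₀, hγ₀τ⟩ := mem_proj.1 hτ₀
  obtain ⟨-, γ₁, hγ₁, hγ₁τ⟩ := mem_proj.1 hτ₁
  have : γ₀ = γ₁ := hS.eq_of_compat γ₀ (h₀ hγ₀) γ₁ (h₁ hγ₁)
    ((hT τ hτ).compat_of_subset_of_subset hγ₀τ hγ₁τ)
  exact Finset.disjoint_left.1 hd hγ₀ (this ▸ hγ₁)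

/-- **Lemma 12.3.7(3)**: for `S ◁ T` (`S` `k`-complete, `T` `ℓ`-complete, `k + ℓ ≤ n`) and
`S₀ ⊆ S`, projection turns relative complement into complement: `T(S ∖ S₀) = T ∖ T(S₀)`.
[cite: Krajicek1995, Lemma 12.3.7(3)] -/
theorem proj_sdiff {D : Finset α} {R : Finset β} {k ℓ : ℕ} {S S₀ T : Finset (Finset (α × β))}
    (hST : Refines S T) (hS : IsKComplete D R k S) (hT : IsKComplete D R ℓ T)
    (hkl : k + ℓ ≤ R.card) (h₀ : S₀ ⊆ S) : proj T (S \ S₀) = T \ proj T S₀ := by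
  have hu : proj T (S \ S₀) ∪ proj T S₀ = T := by
    rw [← proj_union, Finset.sdiff_union_of_subset h₀, proj_self hST hS hT hkl]
  have hdis : Disjoint (proj T (S \ S₀)) (proj T S₀) :=
    disjoint_proj hS Finset.sdiff_subset h₀ Finset.sdiff_disjoint hT.isPMatching
  calc proj T (S \ S₀) = (proj T (S \ S₀) ∪ proj T S₀) \ proj T S₀ :=
        (Finset.union_sdiff_cancel_right hdis).symm
    _ = T \ proj T S₀ := by rw [hu]


/-- If every element of `S` is compatible with some element of `H` and `H ◁ S`, then `H` is
*true* in `S`: `S(H) = S`. (The form in which Lemma 12.3.6 is applied to the pigeonhole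
axioms, Krajíček 1995, Lemma 12.5.2 / Krajíček 2019, Lemma 15.1.6.) [cite: Krajicek1995, Lemma 12.5.2] -/
theorem proj_eq_self_of_forall_exists_compat {H S : Finset (Finset (α × β))} (hHS : Refines H S)
    (hH : ∀ σ ∈ S, ∃ γ ∈ H, Compat γ σ) : proj S H = S := by
  ext σ
  rw [mem_proj]
  exact ⟨fun h => h.1, fun hσ => ⟨hσ, hHS σ hσ (hH σ hσ)⟩⟩

/-- The empty set is refined by everything. [folklore] -/
theorem refines_empty_left (S : Finset (Finset (α × β))) : Refines ∅ S := by
  rintro σ _ ⟨γ, hγ, _⟩; exact absurd hγ (Finset.notMem_empty γ)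

/-- `{∅}` is refined by everything. [cite: Krajicek1995, §12.4 (remark before Lemma 12.4.2)] -/
theorem refines_singleton_empty_left (S : Finset (Finset (α × β))) : Refines {∅} S := by
  rintro σ _ _; exact ⟨∅, Finset.mem_singleton_self _, Finset.empty_subset _⟩

/-- Projecting `{∅}` gives everything. [folklore] -/
@[simp] theorem proj_singleton_empty (S : Finset (Finset (α × β))) : proj S {∅} = S := by
  ext σ; simp [mem_proj]

/-- The one-element system `{∅}` is `0`-complete (the system of the constants).
[cite: Krajicek1995, Def. 12.4.1(3)] -/
theorem isKComplete_singleton_empty (D : Finset α) (R : Finset β) :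
    IsKComplete D R 0 ({∅} : Finset (Finset (α × β))) where
  isPMatching σ hσ := by rw [Finset.mem_singleton] at hσ; rw [hσ]; exact IsPMatching.empty
  subset σ hσ := by rw [Finset.mem_singleton] at hσ; rw [hσ]; exact Finset.empty_subset _
  card_le σ hσ := by rw [Finset.mem_singleton] at hσ; rw [hσ, Finset.card_empty]
  eq_of_compat σ hσ τ hτ _ := by
    rw [Finset.mem_singleton] at hσ hτ; rw [hσ, hτ]
  exists_compat γ hγ _ _ := ⟨∅, Finset.mem_singleton_self _, hγ.compat_empty⟩

/-! ### Common refinement of a list of systems -/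

/-- The common refinement of a list of systems, `S₁ × (S₂ × (⋯ × {∅}))`.
[cite: Krajicek1995, Lemma 12.3.5 (iterated in the proof of Lemma 12.4.4)] -/
def crefineList : List (Finset (Finset (α × β))) → Finset (Finset (α × β))
  | [] => {∅}
  | S :: l => crefine S (crefineList l)

/-- The common refinement of a list of `k`-complete systems is `(length · k)`-complete.
[cite: Krajicek1995, Lemma 12.3.5 (iterated)] -/
theorem isKComplete_crefineList {D : Finset α} {R : Finset β} {k : ℕ} :
    ∀ (l : List (Finset (Finset (α × β)))), (∀ S ∈ l, IsKComplete D R k S) →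
      IsKComplete D R (l.length * k) (crefineList l)
  | [], _ => by simpa [crefineList] using isKComplete_singleton_empty D R
  | S :: l, h => by
    have hS := h S (List.mem_cons_self ..)
    have hl := isKComplete_crefineList l fun T hT => h T (List.mem_cons_of_mem _ hT)
    have := isKComplete_crefine hS hl
    simpa [crefineList, List.length_cons, Nat.succ_mul, Nat.add_comm] using this

/-- Every member of a list of `k`-complete systems is refined by the common refinement of the
list, provided `2 · length · k ≤ n` (room for Lemma 12.3.4).
[cite: Krajicek1995, Lemma 12.3.5 (iterated), Lemma 12.3.4] -/
theorem refines_crefineList {D : Finset α} {R : Finset β} {k : ℕ} :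
    ∀ (l : List (Finset (Finset (α × β)))), (∀ S ∈ l, IsKComplete D R k S) →
      2 * (l.length * k) ≤ R.card → ∀ S ∈ l, Refines S (crefineList l)
  | [], _, _, S, hS => absurd hS List.not_mem_nil
  | S :: l, h, hlen, U, hU => by
    have hS := h S (List.mem_cons_self ..)
    have hl' : ∀ T ∈ l, IsKComplete D R k T := fun T hT => h T (List.mem_cons_of_mem _ hT)
    have hl := isKComplete_crefineList l hl'
    rcases List.mem_cons.1 hU with rfl | hU
    · exact refines_crefine_left hS
    · have hlen' : 2 * (l.length * k + k) ≤ R.card := by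
        simpa [List.length_cons, Nat.succ_mul] using hlen
      have h1 : Refines U (crefineList l) := refines_crefineList l hl' (by omega) U hU
      have h2 : Refines (crefineList l) (crefine S (crefineList l)) := refines_crefine_right hl
      have h3 := isKComplete_crefine hS hl
      show Refines U (crefine S (crefineList l))
      exact h1.trans h2 hl h3 (by omega)

/-! ### Restrictions (Krajíček 1995, Def. 12.3.8, Lemma 12.3.9) -/

/-- The restriction `H^ρ := {σ ∖ ρ | σ ∈ H, σ ∪ ρ ∈ 𝓜}` of a set of matchings by a matching
`ρ` (elements incompatible with `ρ` are dropped — "`σ^ρ` undefined"). [cite: Krajicek1995, Def. 12.3.8] -/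
def restrict (ρ : Finset (α × β)) (H : Finset (Finset (α × β))) : Finset (Finset (α × β)) :=
  (H.filter fun σ => Compat ρ σ).image fun σ => σ \ ρ

/-- Membership in a restriction. [cite: Krajicek1995, Def. 12.3.8] -/
theorem mem_restrict {ρ : Finset (α × β)} {H : Finset (Finset (α × β))} {τ : Finset (α × β)} :
    τ ∈ restrict ρ H ↔ ∃ σ ∈ H, Compat ρ σ ∧ σ \ ρ = τ := by
  simp only [restrict, Finset.mem_image, Finset.mem_filter]
  constructor
  · rintro ⟨σ, ⟨hσ, hc⟩, rfl⟩; exact ⟨σ, hσ, hc, rfl⟩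
  · rintro ⟨σ, hσ, hc, rfl⟩; exact ⟨σ, ⟨hσ, hc⟩, rfl⟩

/-- An element of `H` compatible with `ρ` yields an element of `H^ρ`. [cite: Krajicek1995, Def. 12.3.8] -/
theorem sdiff_mem_restrict {ρ : Finset (α × β)} {H : Finset (Finset (α × β))} {σ : Finset (α × β)}
    (hσ : σ ∈ H) (hc : Compat ρ σ) : σ \ ρ ∈ restrict ρ H :=
  mem_restrict.2 ⟨σ, hσ, hc, rfl⟩

/-- Restriction of the empty set. [folklore] -/
@[simp] theorem restrict_empty (ρ : Finset (α × β)) : restrict ρ (∅ : Finset (Finset (α × β))) = ∅ := by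
  simp [restrict]

/-- Restriction commutes with unions. [cite: Krajicek1995, Lemma 12.3.9 (proof)] -/
theorem restrict_union (ρ : Finset (α × β)) (H₁ H₂ : Finset (Finset (α × β))) :
    restrict ρ (H₁ ∪ H₂) = restrict ρ H₁ ∪ restrict ρ H₂ := by
  simp [restrict, Finset.filter_union, Finset.image_union]

/-- Restriction commutes with indexed unions. [cite: Krajicek1995, Lemma 12.3.9 (proof)] -/
theorem restrict_biUnion {ι : Type*} [DecidableEq ι] (ρ : Finset (α × β)) (I : Finset ι)
    (H : ι → Finset (Finset (α × β))) :
    restrict ρ (I.biUnion H) = I.biUnion fun i => restrict ρ (H i) := by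
  simp [restrict, Finset.filter_biUnion, Finset.biUnion_image]

/-- Restriction is monotone. [folklore] -/
theorem restrict_mono (ρ : Finset (α × β)) {H H' : Finset (Finset (α × β))} (h : H ⊆ H') :
    restrict ρ H ⊆ restrict ρ H' :=
  Finset.image_subset_image (Finset.filter_subset_filter _ h)

/-- The restriction `{∅}^ρ = {∅}`. [cite: Krajicek1995, Lemma 12.4.2] -/
@[simp] theorem restrict_singleton_empty {ρ : Finset (α × β)} (hρ : IsPMatching ρ) :
    restrict ρ ({∅} : Finset (Finset (α × β))) = {∅} := by
  ext τ
  rw [mem_restrict, Finset.mem_singleton]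
  constructor
  · rintro ⟨σ, hσ, -, rfl⟩; rw [Finset.mem_singleton] at hσ; rw [hσ, Finset.empty_sdiff]
  · rintro rfl
    exact ⟨∅, Finset.mem_singleton_self _, by unfold Compat; rwa [Finset.union_empty],
      Finset.empty_sdiff _⟩

/-- For `σ, τ` compatible with `ρ`: `σ ∖ ρ` and `τ ∖ ρ` are compatible iff `σ` and `τ` are.
[cite: Krajicek1995, Lemma 12.3.9 (proof of parts 1–2)] -/
theorem compat_sdiff_iff {ρ σ τ : Finset (α × β)} (hσ : Compat ρ σ) (hτ : Compat ρ τ) :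
    Compat (σ \ ρ) (τ \ ρ) ↔ Compat σ τ := by
  refine ⟨fun h => ?_, fun h => (h.mono_left Finset.sdiff_subset).mono_right Finset.sdiff_subset⟩
  rw [compat_iff] at h hσ hτ ⊢
  refine ⟨hσ.2.1, hτ.2.1, fun p hp q hq hpq => ?_⟩
  by_cases hpρ : p ∈ ρ
  · exact hτ.2.2 p hpρ q hq hpq
  by_cases hqρ : q ∈ ρ
  · exact (hσ.2.2 q hqρ p hp (hpq.imp Eq.symm Eq.symm)).symm
  · exact h.2.2 p (Finset.mem_sdiff.2 ⟨hp, hpρ⟩) q (Finset.mem_sdiff.2 ⟨hq, hqρ⟩) hpq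

/-- Elements of a system of pairwise incompatible matchings with equal restrictions are
equal (the map `σ ↦ σ^ρ` is injective where defined). [cite: Krajicek1995, Lemma 12.3.9(2) (proof)] -/
theorem IsKComplete.eq_of_sdiff_eq {D : Finset α} {R : Finset β} {k : ℕ}
    {S : Finset (Finset (α × β))} (hS : IsKComplete D R k S) {ρ σ τ : Finset (α × β)}
    (hσ : σ ∈ S) (hτ : τ ∈ S) (hρσ : Compat ρ σ) (hρτ : Compat ρ τ) (h : σ \ ρ = τ \ ρ) :
    σ = τ := by
  refine hS.eq_of_compat σ hσ τ hτ ((compat_sdiff_iff hρσ hρτ).1 ?_)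
  rw [h]
  exact (hρτ.right.subset Finset.sdiff_subset).compat_self

/-- A matching compatible with `ρ`, minus `ρ`, lives in the restricted universe
`D^ρ × R^ρ = (D ∖ dom ρ) × (R ∖ rng ρ)`. [cite: Krajicek1995, Def. 12.3.8 (𝓜^ρ)] -/
theorem sdiff_subset_restrictedUniverse {D : Finset α} {R : Finset β} {ρ σ : Finset (α × β)}
    (hσ : σ ⊆ D ×ˢ R) (hc : Compat ρ σ) : σ \ ρ ⊆ (D \ dom ρ) ×ˢ (R \ rng ρ) := by
  intro p hp
  rw [Finset.mem_sdiff] at hp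
  have hpD := Finset.mem_product.1 (hσ hp.1)
  rw [Finset.mem_product, Finset.mem_sdiff, Finset.mem_sdiff]
  refine ⟨⟨hpD.1, fun h1 => hp.2 ?_⟩, ⟨hpD.2, fun h2 => hp.2 ?_⟩⟩
  · exact hc.symm.mem_of_mem_of_mem_dom hp.1 h1
  · exact hc.symm.mem_of_mem_of_mem_rng hp.1 h2

/-- A matching of the restricted universe `D^ρ × R^ρ` is compatible with `ρ`; indeed its union
with `ρ` is a matching. [cite: Krajicek1995, Lemma 12.3.9(2) (proof)] -/
theorem compat_of_subset_restrictedUniverse {D : Finset α} {R : Finset β} {ρ γ : Finset (α × β)}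
    (hρ : IsPMatching ρ) (hγ : IsPMatching γ) (hγs : γ ⊆ (D \ dom ρ) ×ˢ (R \ rng ρ)) :
    Compat ρ γ := by
  rw [compat_iff]
  refine ⟨hρ, hγ, fun p hp q hq hpq => ?_⟩
  have hq' := Finset.mem_product.1 (hγs hq)
  rw [Finset.mem_sdiff, Finset.mem_sdiff] at hq'
  rcases hpq with h1 | h2
  · exact absurd (mem_dom.2 ⟨p.2, by rw [← h1]; exact hp⟩) hq'.1.2
  · exact absurd (mem_rng.2 ⟨p.1, by rw [← h2]; exact hp⟩) hq'.2.2

omit [DecidableEq α] in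
/-- The number of holes of the restricted universe: `|R^ρ| = |R| - |ρ|`, stated additively.
[cite: Krajicek1995, Def. 12.3.8 (n^ρ = n − |ρ|)] -/
theorem card_restrictedRange {D : Finset α} {R : Finset β} {ρ : Finset (α × β)}
    (hρ : IsPMatching ρ) (hρs : ρ ⊆ D ×ˢ R) : (R \ rng ρ).card + ρ.card = R.card := by
  rw [← hρ.card_rng, Finset.card_sdiff_add_card_eq_card (rng_subset_of_subset_product hρs)]

omit [DecidableEq β] in
/-- The number of pigeons of the restricted universe: `|D^ρ| = |D| - |ρ|`, stated additively.
[cite: Krajicek1995, Def. 12.3.8] -/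
theorem card_restrictedDomain {D : Finset α} {R : Finset β} {ρ : Finset (α × β)}
    (hρ : IsPMatching ρ) (hρs : ρ ⊆ D ×ˢ R) : (D \ dom ρ).card + ρ.card = D.card := by
  rw [← hρ.card_dom, Finset.card_sdiff_add_card_eq_card (dom_subset_of_subset_product hρs)]

/-- **Lemma 12.3.9(1)**: restriction preserves refinement, `H ◁ S ⟹ H^ρ ◁ S^ρ`.
[cite: Krajicek1995, Lemma 12.3.9(1)] -/
theorem Refines.restrict {H S : Finset (Finset (α × β))} (h : Refines H S) (ρ : Finset (α × β)) :
    Refines (restrict ρ H) (restrict ρ S) := by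
  rintro τ' hτ' ⟨γ', hγ', hc⟩
  obtain ⟨τ, hτ, hρτ, rfl⟩ := mem_restrict.1 hτ'
  obtain ⟨γ, hγ, hργ, rfl⟩ := mem_restrict.1 hγ'
  obtain ⟨γ₁, hγ₁, hγ₁τ⟩ := h τ hτ ⟨γ, hγ, (compat_sdiff_iff hργ hρτ).1 hc⟩
  exact ⟨γ₁ \ ρ, sdiff_mem_restrict hγ₁ (hρτ.mono_right hγ₁τ),
    Finset.sdiff_subset_sdiff hγ₁τ le_rfl⟩

/-- **Lemma 12.3.9(2)**: the restriction of a `k`-complete system over `D × R` by a matching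
`ρ` of the universe is `k`-complete over the restricted universe `D^ρ × R^ρ` (Krajíček's side
condition `|ρ| + k ≤ n` is automatic with our additive phrasing of completeness).
[cite: Krajicek1995, Lemma 12.3.9(2)] -/
theorem IsKComplete.restrict {D : Finset α} {R : Finset β} {k : ℕ} {S : Finset (Finset (α × β))}
    (hS : IsKComplete D R k S) {ρ : Finset (α × β)} (hρ : IsPMatching ρ) (hρs : ρ ⊆ D ×ˢ R) :
    IsKComplete (D \ dom ρ) (R \ rng ρ) k (restrict ρ S) where
  isPMatching τ hτ := by
    obtain ⟨σ, hσ, _, rfl⟩ := mem_restrict.1 hτ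
    exact (hS.isPMatching σ hσ).subset Finset.sdiff_subset
  subset τ hτ := by
    obtain ⟨σ, hσ, hc, rfl⟩ := mem_restrict.1 hτ
    exact sdiff_subset_restrictedUniverse (hS.subset σ hσ) hc
  card_le τ hτ := by
    obtain ⟨σ, hσ, _, rfl⟩ := mem_restrict.1 hτ
    exact (Finset.card_le_card Finset.sdiff_subset).trans (hS.card_le σ hσ)
  eq_of_compat τ hτ τ' hτ' hc := by
    obtain ⟨σ, hσ, hρσ, rfl⟩ := mem_restrict.1 hτ
    obtain ⟨σ', hσ', hρσ', rfl⟩ := mem_restrict.1 hτ'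
    rw [hS.eq_of_compat σ hσ σ' hσ' ((compat_sdiff_iff hρσ hρσ').1 hc)]
  exists_compat γ hγ hγs hcard := by
    have hργ : Compat ρ γ := compat_of_subset_restrictedUniverse hρ hγ hγs
    have hγρs : γ ∪ ρ ⊆ D ×ˢ R := by
      refine Finset.union_subset (hγs.trans ?_) hρs
      exact Finset.product_subset_product Finset.sdiff_subset Finset.sdiff_subset
    have hcard' : (γ ∪ ρ).card + k ≤ R.card := by
      have h1 := Finset.card_union_le γ ρ
      have h2 := card_restrictedRange hρ hρs (D := D)
      omega
    obtain ⟨σ, hσ, hσc⟩ := hS.exists_compat (γ ∪ ρ) (by simpa [Compat, Finset.union_comm] using hργ)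
      hγρs hcard'
    have hρσ : Compat ρ σ := (hσc.mono_right Finset.subset_union_right).symm
    refine ⟨σ \ ρ, sdiff_mem_restrict hσ hρσ, ?_⟩
    exact (hσc.mono_right Finset.subset_union_left).mono_left Finset.sdiff_subset

/-- **Lemma 12.3.9(3)**: for `H ◁ S` (`S` consisting of matchings), restriction commutes with
projection: `(S(H))^ρ = S^ρ(H^ρ)`. [cite: Krajicek1995, Lemma 12.3.9(3)] -/
theorem restrict_proj {H S : Finset (Finset (α × β))} (h : Refines H S)
    (hS : ∀ σ ∈ S, IsPMatching σ) (ρ : Finset (α × β)) :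
    restrict ρ (proj S H) = proj (restrict ρ S) (restrict ρ H) := by
  ext τ
  rw [mem_restrict, mem_proj]
  constructor
  · rintro ⟨κ, hκ, hρκ, rfl⟩
    obtain ⟨hκS, γ, hγ, hγκ⟩ := mem_proj.1 hκ
    exact ⟨sdiff_mem_restrict hκS hρκ, γ \ ρ, sdiff_mem_restrict hγ (hρκ.mono_right hγκ),
      Finset.sdiff_subset_sdiff hγκ le_rfl⟩
  · rintro ⟨hτ, γ', hγ', hγ'τ⟩
    obtain ⟨σ, hσ, hρσ, rfl⟩ := mem_restrict.1 hτ
    obtain ⟨γ, hγ, hργ, rfl⟩ := mem_restrict.1 hγ'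
    have hc : Compat γ σ := by
      rw [← compat_sdiff_iff hργ hρσ]
      exact ((hS σ hσ).subset Finset.sdiff_subset).compat_of_subset hγ'τ
    obtain ⟨γ₁, hγ₁, hγ₁σ⟩ := h σ hσ ⟨γ, hγ, hc⟩
    exact ⟨σ, mem_proj.2 ⟨hσ, γ₁, hγ₁, hγ₁σ⟩, hρσ, rfl⟩

/-- Restriction commutes with relative complements inside a system of pairwise incompatible
matchings: `(S ∖ H)^ρ = S^ρ ∖ H^ρ` for `H ⊆ S`. [cite: Krajicek1995, Lemma 12.4.2 (negation clause)] -/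
theorem restrict_sdiff {D : Finset α} {R : Finset β} {k : ℕ} {H S : Finset (Finset (α × β))}
    (hS : IsKComplete D R k S) (hH : H ⊆ S) (ρ : Finset (α × β)) :
    restrict ρ (S \ H) = restrict ρ S \ restrict ρ H := by
  ext τ
  rw [Finset.mem_sdiff, mem_restrict, mem_restrict, mem_restrict]
  constructor
  · rintro ⟨σ, hσ, hρσ, rfl⟩
    rw [Finset.mem_sdiff] at hσ
    refine ⟨⟨σ, hσ.1, hρσ, rfl⟩, ?_⟩
    rintro ⟨γ, hγ, hργ, hγσ⟩
    have := hS.eq_of_sdiff_eq (hH hγ) hσ.1 hργ hρσ hγσ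
    exact hσ.2 (this ▸ hγ)
  · rintro ⟨⟨σ, hσ, hρσ, rfl⟩, h2⟩
    refine ⟨σ, Finset.mem_sdiff.2 ⟨hσ, fun hσH => h2 ⟨σ, hσH, hρσ, rfl⟩⟩, hρσ, rfl⟩

/-- If `H = S` then `H^ρ = S^ρ`; recorded for symmetry with `restrict_sdiff`: a formula true
in `S` stays true after restriction. [cite: Krajicek1995, Lemma 12.4.2] -/
theorem restrict_subset_restrict {H S : Finset (Finset (α × β))} (h : H ⊆ S) (ρ : Finset (α × β)) :
    restrict ρ H ⊆ restrict ρ S :=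
  restrict_mono ρ h

/-! ### The systems of atoms (Krajíček 1995, Lemma 12.3.2) -/

/-- The `1`-complete system of a pigeon `i`: `{ {(i, j)} | j ∈ R }` ("where does `i` go?").
[cite: Krajicek1995, Lemma 12.3.2(1)] -/
def pigeonSystem (R : Finset β) (i : α) : Finset (Finset (α × β)) :=
  R.image fun j => {(i, j)}

/-- The `1`-complete system of a hole `j`: `{ {(i, j)} | i ∈ D }` ("who sits in `j`?").
[cite: Krajicek1995, Lemma 12.3.2(1) (dual form); Krajicek2019 §15.1] -/
def holeSystem (D : Finset α) (j : β) : Finset (Finset (α × β)) :=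
  D.image fun i => {(i, j)}

/-- The `2`-complete system of the atom `p_{ij}`:
`{ {(i, j)} } ∪ { {(i, j'), (i', j)} | i ≠ i' ∈ D, j ≠ j' ∈ R }`.
[cite: Krajicek1995, Lemma 12.3.2(2), Def. 12.4.1(4)] -/
def atomSystem (D : Finset α) (R : Finset β) (i : α) (j : β) : Finset (Finset (α × β)) :=
  insert {(i, j)} (((D.erase i) ×ˢ (R.erase j)).image fun p => {(i, p.2), (p.1, j)})

/-- Membership in the pigeon system. [cite: Krajicek1995, Lemma 12.3.2(1)] -/
theorem mem_pigeonSystem {R : Finset β} {i : α} {σ : Finset (α × β)} :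
    σ ∈ pigeonSystem R i ↔ ∃ j ∈ R, σ = {(i, j)} := by
  simp only [pigeonSystem, Finset.mem_image]
  exact ⟨fun ⟨j, hj, h⟩ => ⟨j, hj, h.symm⟩, fun ⟨j, hj, h⟩ => ⟨j, hj, h.symm⟩⟩

/-- Membership in the hole system. [cite: Krajicek1995, Lemma 12.3.2(1)] -/
theorem mem_holeSystem {D : Finset α} {j : β} {σ : Finset (α × β)} :
    σ ∈ holeSystem D j ↔ ∃ i ∈ D, σ = {(i, j)} := by
  simp only [holeSystem, Finset.mem_image]
  exact ⟨fun ⟨i, hi, h⟩ => ⟨i, hi, h.symm⟩, fun ⟨i, hi, h⟩ => ⟨i, hi, h.symm⟩⟩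

/-- Membership in the atom system. [cite: Krajicek1995, Lemma 12.3.2(2)] -/
theorem mem_atomSystem {D : Finset α} {R : Finset β} {i : α} {j : β} {σ : Finset (α × β)} :
    σ ∈ atomSystem D R i j ↔
      σ = {(i, j)} ∨ ∃ i' ∈ D, ∃ j' ∈ R, i' ≠ i ∧ j' ≠ j ∧ σ = {(i, j'), (i', j)} := by
  simp only [atomSystem, Finset.mem_insert, Finset.mem_image, Finset.mem_product,
    Finset.mem_erase, Prod.exists]
  constructor
  · rintro (h | ⟨i', j', ⟨⟨hi', hi'D⟩, hj', hj'R⟩, h⟩)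
    · exact Or.inl h
    · exact Or.inr ⟨i', hi'D, j', hj'R, hi', hj', h.symm⟩
  · rintro (h | ⟨i', hi'D, j', hj'R, hi', hj', h⟩)
    · exact Or.inl h
    · exact Or.inr ⟨i', j', ⟨⟨hi', hi'D⟩, hj', hj'R⟩, h.symm⟩

omit [DecidableEq α] [DecidableEq β] in
/-- `|s| ≤ |s ∖ t| + |t|`. [folklore] -/
theorem card_le_card_sdiff_add {ι : Type*} [DecidableEq ι] (s t : Finset ι) :
    s.card ≤ (s \ t).card + t.card :=
  (Finset.card_le_card (fun x hx => by
    rw [Finset.mem_union, Finset.mem_sdiff]; by_cases h : x ∈ t <;> simp [hx, h])).trans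
    (Finset.card_union_le (s \ t) t)

omit [DecidableEq α] in
/-- In a matching `γ` with `|γ| + 2 ≤ |R|` there is a hole of `R` outside `rng γ` and
different from a prescribed hole `j`. [folklore] -/
theorem exists_fresh_hole {R : Finset β} {γ : Finset (α × β)} (hγ : IsPMatching γ) (j : β)
    (hcard : γ.card + 2 ≤ R.card) : ∃ j' ∈ R, j' ∉ rng γ ∧ j' ≠ j := by
  have h : ((R \ rng γ).erase j).Nonempty := by
    rw [← Finset.card_pos]
    have h1 := card_le_card_sdiff_add R (rng γ)
    have h2 := Finset.pred_card_le_card_erase (s := R \ rng γ) (a := j)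
    rw [hγ.card_rng] at h1
    omega
  obtain ⟨j', hj'⟩ := h
  rw [Finset.mem_erase, Finset.mem_sdiff] at hj'
  exact ⟨j', hj'.2.1, hj'.2.2, hj'.1⟩

omit [DecidableEq β] in
/-- Dually, a fresh pigeon avoiding `dom γ` and one extra pigeon. [folklore] -/
theorem exists_fresh_pigeon {D : Finset α} {γ : Finset (α × β)} (hγ : IsPMatching γ) (i : α)
    (hcard : γ.card + 2 ≤ D.card) : ∃ i' ∈ D, i' ∉ dom γ ∧ i' ≠ i := by
  have h : ((D \ dom γ).erase i).Nonempty := by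
    rw [← Finset.card_pos]
    have h1 := card_le_card_sdiff_add D (dom γ)
    have h2 := Finset.pred_card_le_card_erase (s := D \ dom γ) (a := i)
    rw [hγ.card_dom] at h1
    omega
  obtain ⟨i', hi'⟩ := h
  rw [Finset.mem_erase, Finset.mem_sdiff] at hi'
  exact ⟨i', hi'.2.1, hi'.2.2, hi'.1⟩

/-- **Lemma 12.3.2(1)**: the pigeon system of `i ∈ D` is `1`-complete.
[cite: Krajicek1995, Lemma 12.3.2(1)] -/
theorem isKComplete_pigeonSystem {D : Finset α} {R : Finset β} {i : α} (hi : i ∈ D) :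
    IsKComplete D R 1 (pigeonSystem R i : Finset (Finset (α × β))) where
  isPMatching σ hσ := by
    obtain ⟨j, _, rfl⟩ := mem_pigeonSystem.1 hσ; exact IsPMatching.singleton _
  subset σ hσ := by
    obtain ⟨j, hj, rfl⟩ := mem_pigeonSystem.1 hσ
    exact Finset.singleton_subset_iff.2 (Finset.mem_product.2 ⟨hi, hj⟩)
  card_le σ hσ := by
    obtain ⟨j, _, rfl⟩ := mem_pigeonSystem.1 hσ; rw [Finset.card_singleton]
  eq_of_compat σ hσ τ hτ hc := by
    obtain ⟨j, _, rfl⟩ := mem_pigeonSystem.1 hσ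
    obtain ⟨j', _, rfl⟩ := mem_pigeonSystem.1 hτ
    have := (compat_iff.1 hc).2.2 (i, j) (Finset.mem_singleton_self _) (i, j')
      (Finset.mem_singleton_self _) (Or.inl rfl)
    rw [this]
  exists_compat γ hγ hγs hcard := by
    by_cases hid : i ∈ dom γ
    · obtain ⟨j, hj⟩ := mem_dom.1 hid
      exact ⟨{(i, j)}, mem_pigeonSystem.2 ⟨j, (Finset.mem_product.1 (hγs hj)).2, rfl⟩,
        hγ.compat_singleton_of_mem hj⟩
    · have h : (R \ rng γ).Nonempty := by
        rw [← Finset.card_pos]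
        have h1 := card_le_card_sdiff_add R (rng γ)
        rw [hγ.card_rng] at h1
        omega
      obtain ⟨j, hj⟩ := h
      rw [Finset.mem_sdiff] at hj
      exact ⟨{(i, j)}, mem_pigeonSystem.2 ⟨j, hj.1, rfl⟩, hγ.compat_singleton_of_fresh hid hj.2⟩

/-- **Lemma 12.3.2(1)**, dual: the hole system of `j ∈ R` is `1`-complete when `|R| ≤ |D|`.
[cite: Krajicek1995, Lemma 12.3.2(1)] -/
theorem isKComplete_holeSystem {D : Finset α} {R : Finset β} {j : β} (hj : j ∈ R)
    (hDR : R.card ≤ D.card) : IsKComplete D R 1 (holeSystem D j : Finset (Finset (α × β))) where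
  isPMatching σ hσ := by
    obtain ⟨i, _, rfl⟩ := mem_holeSystem.1 hσ; exact IsPMatching.singleton _
  subset σ hσ := by
    obtain ⟨i, hi, rfl⟩ := mem_holeSystem.1 hσ
    exact Finset.singleton_subset_iff.2 (Finset.mem_product.2 ⟨hi, hj⟩)
  card_le σ hσ := by
    obtain ⟨i, _, rfl⟩ := mem_holeSystem.1 hσ; rw [Finset.card_singleton]
  eq_of_compat σ hσ τ hτ hc := by
    obtain ⟨i, _, rfl⟩ := mem_holeSystem.1 hσ
    obtain ⟨i', _, rfl⟩ := mem_holeSystem.1 hτ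
    have := (compat_iff.1 hc).2.2 (i, j) (Finset.mem_singleton_self _) (i', j)
      (Finset.mem_singleton_self _) (Or.inr rfl)
    rw [this]
  exists_compat γ hγ hγs hcard := by
    by_cases hjr : j ∈ rng γ
    · obtain ⟨i, hi⟩ := mem_rng.1 hjr
      exact ⟨{(i, j)}, mem_holeSystem.2 ⟨i, (Finset.mem_product.1 (hγs hi)).1, rfl⟩,
        hγ.compat_singleton_of_mem hi⟩
    · have h : (D \ dom γ).Nonempty := by
        rw [← Finset.card_pos]
        have h1 := card_le_card_sdiff_add D (dom γ)
        rw [hγ.card_dom] at h1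
        omega
      obtain ⟨i, hi⟩ := h
      rw [Finset.mem_sdiff] at hi
      exact ⟨{(i, j)}, mem_holeSystem.2 ⟨i, hi.1, rfl⟩, hγ.compat_singleton_of_fresh hi.2 hjr⟩

/-- The two-element matchings of the atom system are matchings. [folklore] -/
theorem isPMatching_pair {i i' : α} {j j' : β} (hi : i' ≠ i) (hj : j' ≠ j) :
    IsPMatching ({(i, j'), (i', j)} : Finset (α × β)) := by
  rintro ⟨pa, pb⟩ hp ⟨qa, qb⟩ hq hpq
  simp only [Finset.mem_insert, Finset.mem_singleton, Prod.mk.injEq] at hp hq hpq ⊢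
  rcases hp with ⟨rfl, rfl⟩ | ⟨rfl, rfl⟩ <;> rcases hq with ⟨rfl, rfl⟩ | ⟨rfl, rfl⟩
  · exact ⟨rfl, rfl⟩
  · rcases hpq with h | h
    · exact absurd h.symm hi
    · exact absurd h hj
  · rcases hpq with h | h
    · exact absurd h hi
    · exact absurd h.symm hj
  · exact ⟨rfl, rfl⟩

/-- The combinatorial heart of Lemma 12.3.2(2): a matching `γ` of the universe with
`|γ| + 2 ≤ |R| ≤ |D|` not containing `(i, j)` is compatible with a two-element member
`{(i, j'), (i', j)}` of the atom system of `p_{ij}`. (Also used for the hole axioms of PHP,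
Krajíček 1995, Lemma 12.5.2.) [cite: Krajicek1995, Lemma 12.3.2(2)] -/
theorem exists_pair_compat_of_not_mem {D : Finset α} {R : Finset β} {i : α} {j : β} (hi : i ∈ D)
    (hDR : R.card ≤ D.card) {γ : Finset (α × β)} (hγ : IsPMatching γ) (hγs : γ ⊆ D ×ˢ R)
    (hcard : γ.card + 2 ≤ R.card) (hij : (i, j) ∉ γ) :
    ∃ i' ∈ D, ∃ j' ∈ R, i' ≠ i ∧ j' ≠ j ∧ Compat ({(i, j'), (i', j)} : Finset (α × β)) γ := by
  -- choose the image `j'` of `i`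
  obtain ⟨j', hj'R, hj'j, γ₁, hγ₁, hγγ₁, hij', hγ₁s, hγ₁c⟩ :
      ∃ j' ∈ R, j' ≠ j ∧ ∃ γ₁ : Finset (α × β), IsPMatching γ₁ ∧ γ ⊆ γ₁ ∧ (i, j') ∈ γ₁ ∧
        γ₁ ⊆ D ×ˢ R ∧ γ₁.card ≤ γ.card + 1 := by
    by_cases hid : i ∈ dom γ
    · obtain ⟨j', hj'⟩ := mem_dom.1 hid
      refine ⟨j', (Finset.mem_product.1 (hγs hj')).2, fun h => hij (h ▸ hj'), γ, hγ, le_rfl,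
        hj', hγs, Nat.le_succ _⟩
    · obtain ⟨j', hj'R, hj'r, hj'j⟩ := exists_fresh_hole hγ j hcard
      refine ⟨j', hj'R, hj'j, insert (i, j') γ, hγ.insert hid hj'r, Finset.subset_insert _ _,
        Finset.mem_insert_self _ _, ?_, Finset.card_insert_le _ _⟩
      exact Finset.insert_subset (Finset.mem_product.2 ⟨hi, hj'R⟩) hγs
  -- choose the preimage `i'` of `j`
  have hij₁ : (i, j) ∉ γ₁ := fun h => hj'j (hγ₁.eq_of_fst_eq hij' h)
  obtain ⟨i', hi'D, hi'i, γ₂, hγ₂, hγ₁γ₂, hi'j⟩ :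
      ∃ i' ∈ D, i' ≠ i ∧ ∃ γ₂ : Finset (α × β), IsPMatching γ₂ ∧ γ₁ ⊆ γ₂ ∧ (i', j) ∈ γ₂ := by
    by_cases hjr : j ∈ rng γ₁
    · obtain ⟨i', hi'⟩ := mem_rng.1 hjr
      exact ⟨i', (Finset.mem_product.1 (hγ₁s hi')).1, fun h => hij₁ (h ▸ hi'), γ₁, hγ₁,
        le_rfl, hi'⟩
    · have h : (D \ dom γ₁).Nonempty := by
        rw [← Finset.card_pos]
        have h1 := card_le_card_sdiff_add D (dom γ₁)
        rw [hγ₁.card_dom] at h1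
        omega
      obtain ⟨i', hi'⟩ := h
      rw [Finset.mem_sdiff] at hi'
      exact ⟨i', hi'.1, fun h => hi'.2 (h ▸ mem_dom.2 ⟨j', hij'⟩), insert (i', j) γ₁,
        hγ₁.insert hi'.2 hjr, Finset.subset_insert _ _, Finset.mem_insert_self _ _⟩
  refine ⟨i', hi'D, j', hj'R, hi'i, hj'j, hγ₂.compat_of_subset_of_subset ?_ (hγγ₁.trans hγ₁γ₂)⟩
  rw [Finset.insert_subset_iff, Finset.singleton_subset_iff]
  exact ⟨hγ₁γ₂ hij', hi'j⟩

/-- **Lemma 12.3.2(2)**: the atom system of `p_{ij}` (`i ∈ D`, `j ∈ R`, `|R| ≤ |D|`) is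
`2`-complete. [cite: Krajicek1995, Lemma 12.3.2(2)] -/
theorem isKComplete_atomSystem {D : Finset α} {R : Finset β} {i : α} {j : β} (hi : i ∈ D)
    (hj : j ∈ R) (hDR : R.card ≤ D.card) : IsKComplete D R 2 (atomSystem D R i j) where
  isPMatching σ hσ := by
    rcases mem_atomSystem.1 hσ with rfl | ⟨i', _, j', _, hi', hj', rfl⟩
    · exact IsPMatching.singleton _
    · exact isPMatching_pair hi' hj'
  subset σ hσ := by
    rcases mem_atomSystem.1 hσ with rfl | ⟨i', hi'D, j', hj'R, _, _, rfl⟩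
    · exact Finset.singleton_subset_iff.2 (Finset.mem_product.2 ⟨hi, hj⟩)
    · rw [Finset.insert_subset_iff, Finset.singleton_subset_iff, Finset.mem_product,
        Finset.mem_product]
      exact ⟨⟨hi, hj'R⟩, hi'D, hj⟩
  card_le σ hσ := by
    rcases mem_atomSystem.1 hσ with rfl | ⟨i', _, j', _, _, _, rfl⟩
    · rw [Finset.card_singleton]; omega
    · exact Finset.card_insert_le _ _ |>.trans (by rw [Finset.card_singleton])
  eq_of_compat σ hσ τ hτ hc := by
    have key : ∀ {i₁ i₂ : α} {j₁ j₂ : β}, i₁ ≠ i → j₁ ≠ j →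
        Compat ({(i, j₁), (i₁, j)} : Finset (α × β)) {(i, j₂), (i₂, j)} →
        ({(i, j₁), (i₁, j)} : Finset (α × β)) = {(i, j₂), (i₂, j)} := by
      intro i₁ i₂ j₁ j₂ _ _ hc
      have hx := (compat_iff.1 hc).2.2
      have h1 := hx (i, j₁) (by simp) (i, j₂) (by simp) (Or.inl rfl)
      have h2 := hx (i₁, j) (by simp) (i₂, j) (by simp) (Or.inr rfl)
      simp only [Prod.mk.injEq] at h1 h2
      rw [h1.2, h2.1]
    have key' : ∀ {i₁ : α} {j₁ : β}, j₁ ≠ j →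
        ¬ Compat ({(i, j)} : Finset (α × β)) {(i, j₁), (i₁, j)} := by
      intro i₁ j₁ hj₁ hc
      have := (compat_iff.1 hc).2.2 (i, j) (by simp) (i, j₁) (by simp) (Or.inl rfl)
      simp only [Prod.mk.injEq, true_and] at this
      exact hj₁ this.symm
    rcases mem_atomSystem.1 hσ with rfl | ⟨i₁, _, j₁, _, hi₁, hj₁, rfl⟩ <;>
      rcases mem_atomSystem.1 hτ with rfl | ⟨i₂, _, j₂, _, hi₂, hj₂, rfl⟩
    · rfl
    · exact absurd hc (key' hj₂)
    · exact absurd hc.symm (key' hj₁)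
    · exact key hi₁ hj₁ hc
  exists_compat γ hγ hγs hcard := by
    by_cases hij : (i, j) ∈ γ
    · exact ⟨{(i, j)}, mem_atomSystem.2 (Or.inl rfl), hγ.compat_singleton_of_mem hij⟩
    · obtain ⟨i', hi'D, j', hj'R, hi'i, hj'j, hc⟩ :=
        exists_pair_compat_of_not_mem hi hDR hγ hγs hcard hij
      exact ⟨{(i, j'), (i', j)}, mem_atomSystem.2 (Or.inr ⟨i', hi'D, j', hj'R, hi'i, hj'j, rfl⟩), hc⟩

/-- Restricting the atom system of `p_{ij}` by a matching `ρ` containing `(i, j)` gives the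
system `{∅}` of the constant `1`. [cite: Krajicek1995, Lemma 12.4.2 (case (p_X)^ρ = 1)] -/
theorem restrict_atomSystem_of_mem {D : Finset α} {R : Finset β} {i : α} {j : β}
    {ρ : Finset (α × β)} (hρ : IsPMatching ρ) (hij : (i, j) ∈ ρ) :
    restrict ρ (atomSystem D R i j) = {∅} := by
  ext τ
  rw [mem_restrict, Finset.mem_singleton]
  constructor
  · rintro ⟨σ, hσ, hc, rfl⟩
    rcases mem_atomSystem.1 hσ with rfl | ⟨i', _, j', _, _, hj', rfl⟩
    · rw [Finset.sdiff_eq_empty_iff_subset, Finset.singleton_subset_iff]; exact hij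
    · exfalso
      have := (compat_iff.1 hc).2.2 (i, j) hij (i, j') (by simp) (Or.inl rfl)
      simp only [Prod.mk.injEq, true_and] at this
      exact hj' this.symm
  · rintro rfl
    refine ⟨{(i, j)}, mem_atomSystem.2 (Or.inl rfl), (hρ.compat_singleton_of_mem hij).symm, ?_⟩
    rw [Finset.sdiff_eq_empty_iff_subset, Finset.singleton_subset_iff]; exact hij

/-- Restricting `{ {p} }` (the truth set of the atom `p = (i, j)`) by `ρ ∋ p` gives `{∅}`.
[cite: Krajicek1995, Lemma 12.4.2 (case (p_X)^ρ = 1)] -/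
theorem restrict_singleton_singleton_of_mem {p : α × β} {ρ : Finset (α × β)}
    (hρ : IsPMatching ρ) (hp : p ∈ ρ) :
    restrict ρ ({{p}} : Finset (Finset (α × β))) = {∅} := by
  ext τ
  rw [mem_restrict, Finset.mem_singleton]
  constructor
  · rintro ⟨σ, hσ, _, rfl⟩
    rw [Finset.mem_singleton] at hσ
    rw [hσ, Finset.sdiff_eq_empty_iff_subset, Finset.singleton_subset_iff]; exact hp
  · rintro rfl
    refine ⟨{p}, Finset.mem_singleton_self _, (hρ.compat_singleton_of_mem hp).symm, ?_⟩
    rw [Finset.sdiff_eq_empty_iff_subset, Finset.singleton_subset_iff]; exact hp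

/-- Restricting `{ {p} }` by a matching incompatible with `p` gives `∅` (the truth set of the
constant `0`). [cite: Krajicek1995, Lemma 12.4.2 (case (p_X)^ρ = 0)] -/
theorem restrict_singleton_singleton_of_not_compat {p : α × β} {ρ : Finset (α × β)}
    (h : ¬ Compat ρ {p}) : restrict ρ ({{p}} : Finset (Finset (α × β))) = ∅ := by
  ext τ
  rw [mem_restrict]
  simp only [Finset.mem_singleton, Finset.notMem_empty, iff_false, not_exists, not_and]
  rintro σ rfl hc
  exact absurd hc h

/-- Restricting `{ {(i, j)} }` by a matching avoiding pigeon `i` and hole `j` changes nothing.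
[cite: Krajicek1995, Lemma 12.4.2 (case (p_X)^ρ = p_X)] -/
theorem restrict_singleton_singleton_of_fresh {i : α} {j : β} {ρ : Finset (α × β)}
    (hρ : IsPMatching ρ) (hid : i ∉ dom ρ) (hjr : j ∉ rng ρ) :
    restrict ρ ({{(i, j)}} : Finset (Finset (α × β))) = {{(i, j)}} := by
  have hc : Compat ρ {(i, j)} := (hρ.compat_singleton_of_fresh hid hjr).symm
  have hd : ({(i, j)} : Finset (α × β)) \ ρ = {(i, j)} := by
    rw [Finset.sdiff_eq_self_iff_disjoint, Finset.disjoint_singleton_left]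
    exact fun h => hid (mem_dom.2 ⟨j, h⟩)
  ext τ
  rw [mem_restrict, Finset.mem_singleton]
  constructor
  · rintro ⟨σ, hσ, _, rfl⟩; rw [Finset.mem_singleton] at hσ; rw [hσ, hd]
  · rintro rfl; exact ⟨{(i, j)}, Finset.mem_singleton_self _, hc, hd⟩

/-- Restricting the atom system of `p_{ij}` by a matching `ρ` of the universe avoiding pigeon
`i` and hole `j` gives the atom system of the restricted universe.
[cite: Krajicek1995, Lemma 12.4.2 (case (p_X)^ρ = p_X)] -/
theorem restrict_atomSystem_of_fresh {D : Finset α} {R : Finset β} {i : α} {j : β}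
    {ρ : Finset (α × β)} (hρ : IsPMatching ρ) (hid : i ∉ dom ρ) (hjr : j ∉ rng ρ) :
    restrict ρ (atomSystem D R i j) = atomSystem (D \ dom ρ) (R \ rng ρ) i j := by
  -- compatibility of the two kinds of elements with `ρ`
  have hc1 : Compat ρ {(i, j)} := (hρ.compat_singleton_of_fresh hid hjr).symm
  have hc2 : ∀ {i' : α} {j' : β}, i' ≠ i → j' ≠ j →
      (Compat ρ {(i, j'), (i', j)} ↔ i' ∉ dom ρ ∧ j' ∉ rng ρ) := by
    intro i' j' hi' hj'
    constructor
    · intro hc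
      have hx := (compat_iff.1 hc).2.2
      constructor
      · intro hd
        obtain ⟨j'', hj''⟩ := mem_dom.1 hd
        have := hx (i', j'') hj'' (i', j) (by simp) (Or.inl rfl)
        simp only [Prod.mk.injEq, true_and] at this
        exact hjr (mem_rng.2 ⟨i', this ▸ hj''⟩)
      · intro hr
        obtain ⟨i'', hi''⟩ := mem_rng.1 hr
        have := hx (i'', j') hi'' (i, j') (by simp) (Or.inr rfl)
        simp only [Prod.mk.injEq, and_true] at this
        exact hid (mem_dom.2 ⟨j', this ▸ hi''⟩)
    · rintro ⟨hd, hr⟩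
      have h1 : IsPMatching (insert (i', j) ρ) := hρ.insert hd hjr
      have h2 : IsPMatching (insert (i, j') (insert (i', j) ρ)) := by
        refine h1.insert ?_ ?_
        · rw [mem_dom]; rintro ⟨b, hb⟩
          rw [Finset.mem_insert, Prod.mk.injEq] at hb
          rcases hb with ⟨h, _⟩ | hb
          · exact hi' h.symm
          · exact hid (mem_dom.2 ⟨b, hb⟩)
        · rw [mem_rng]; rintro ⟨a, ha⟩
          rw [Finset.mem_insert, Prod.mk.injEq] at ha
          rcases ha with ⟨_, h⟩ | ha
          · exact hj' h
          · exact hr (mem_rng.2 ⟨a, ha⟩)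
      refine (h2.compat_of_subset_of_subset ?_ ?_)
      · exact (Finset.subset_insert _ _).trans (Finset.subset_insert _ _)
      · rw [Finset.insert_subset_iff, Finset.singleton_subset_iff]
        exact ⟨Finset.mem_insert_self _ _, Finset.mem_insert_of_mem (Finset.mem_insert_self _ _)⟩
  -- disjointness from `ρ`
  have hd1 : ({(i, j)} : Finset (α × β)) \ ρ = {(i, j)} := by
    rw [Finset.sdiff_eq_self_iff_disjoint, Finset.disjoint_singleton_left]
    exact fun h => hid (mem_dom.2 ⟨j, h⟩)
  have hd2 : ∀ {i' : α} {j' : β}, i' ∉ dom ρ → j' ∉ rng ρ →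
      ({(i, j'), (i', j)} : Finset (α × β)) \ ρ = {(i, j'), (i', j)} := by
    intro i' j' hi' _
    rw [Finset.sdiff_eq_self_iff_disjoint, Finset.disjoint_insert_left,
      Finset.disjoint_singleton_left]
    exact ⟨fun h => hid (mem_dom.2 ⟨j', h⟩), fun h => hi' (mem_dom.2 ⟨j, h⟩)⟩
  ext τ
  rw [mem_restrict, mem_atomSystem]
  constructor
  · rintro ⟨σ, hσ, hc, rfl⟩
    rcases mem_atomSystem.1 hσ with rfl | ⟨i', hi'D, j', hj'R, hi', hj', rfl⟩
    · exact Or.inl hd1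
    · obtain ⟨hi'd, hj'r⟩ := (hc2 hi' hj').1 hc
      refine Or.inr ⟨i', Finset.mem_sdiff.2 ⟨hi'D, hi'd⟩, j', Finset.mem_sdiff.2 ⟨hj'R, hj'r⟩,
        hi', hj', hd2 hi'd hj'r⟩
  · rintro (rfl | ⟨i', hi'D, j', hj'R, hi', hj', rfl⟩)
    · exact ⟨{(i, j)}, mem_atomSystem.2 (Or.inl rfl), hc1, hd1⟩
    · rw [Finset.mem_sdiff] at hi'D hj'R
      exact ⟨{(i, j'), (i', j)}, mem_atomSystem.2 (Or.inr ⟨i', hi'D.1, j', hj'R.1, hi', hj', rfl⟩),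
        (hc2 hi' hj').2 ⟨hi'D.2, hj'R.2⟩, hd2 hi'D.2 hj'R.2⟩

end Literature.Computability.MetaComplexity.PBij
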